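import Literature.NumberTheory.Automorphic.EichlerEmbeddingLocalLevel
import Literature.NumberTheory.EllipticCurves.HeckeFixedPointCount
import HarnessLib

/-!
# k3 · generation 11 sketch for `stub_takahashi` (crux `stmt-ABC-11338`, `DefiniteRTControlPrime`, route `DefiniteXi`)

FAMILY 3 (probe the extremes) on the ONE remaining `M`-size local node of k3's Plan A, gen 10's **H10.14**
`card_optMat_classes_eq` (Voight Prop. 30.6.12 / Hijikata 1974 Thm. 2.3: the number of `O^×`-classes of optimal
matrices with relation `X² - tX + n` in the level-`q^e` Eichler order is `rootCount (ℤ/q^e) + [q ∣ d]·liftRootCount`).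

* T1 **perturbation of the proved neighbour `e = 1` at the COUNTING step.**  The tree's
  `Brandt.LevelHyp.localEmbeddingNumber_eq` (EichlerEmbeddingLocalLevel.lean ll. 1578–1608) counts by a bijection
  `Sum.elim f g` (normalized reps ⊔ star reps) + `Nat.card_congr` + `Nat.card_sum`; at `e = 1` the star index type is
  `PLift (∃ k, …)` (at most ONE new class, injectivity = `Subsingleton.elim`).  For `e ≥ 2` the ONLY new phenomenon is
  SEVERAL star classes (`liftRootCount ≥ 2`; census: up to `16` at `(q,e) = (2,8)`, `9` at `(3,5)`), so the star index becomes the subtype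
  `NewRoots` below and star-injectivity becomes a lemma (H11.7) — everything else clones.
* T2 **minimal counterexample to injectivity.**  If `μ = (p r; c u) ∈ O^×` intertwines `N_x μ = μ N_{x'}`, entries
  `(0,0)`/`(0,1)` give `p (x' - x) = c + r f(x')` with `‖c‖, ‖f(x')‖ ≤ q^{-e}` and `p` a unit: no counterexample, and the
  proof of (B ⇒) is two matrix entries (H11.3, S).  Star classes: transport by `ϖ` (gen 9, PROVED) reduces to the same.
* T3 **certified computation at the extreme gen 8 skipped**: exact `O^×`-conjugacy census (gen-8 classifier verbatim,
  completeness (D) now the kernel-proved gen-9 theorem) in the DEEP regime `v_q(d) ≥ 2e` where multiple star classes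
  live — `scratch/deep_census.py`, table in the memo.

This file: definitions VERBATIM from gens 6/8/9/10 (Cruxes/ modules are not built on the farm), the two index types,
the representative maps, helper statements H11.1–H11.11 (sorried, sizes in docstrings; the ones marked g9 ✓ are
PROVED in `StubIdeas3g9Sketch.lean` and restated only for self-containedness), and the target H10.14 verbatim.
-/

noncomputable section

open scoped Matrix
open Literature.NumberTheory.Automorphic Literature.NumberTheory.Automorphic.Brandt
open Literature.NumberTheory.EllipticCurves.ModularForms (rootCount)

set_option linter.unusedVariables false
set_option linter.dupNamespace false
set_option linter.unusedSectionVars false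

namespace Summit.ABC.ABC.Cruxes.DefiniteRTControlPrime.StubIdeas3g11

/-! ## §0 Definitions (verbatim from gens 6/8/9/10) -/

section Defs

variable {q : ℕ} [hq : Fact q.Prime]

/-- The standard local Eichler order of level `q^e`, `(ℤ_q ℤ_q; q^e ℤ_q ℤ_q)`, as a set of matrices. -/
def eichlerSet (q : ℕ) [Fact q.Prime] (e : ℕ) : Set (Matrix (Fin 2) (Fin 2) ℚ_[q]) :=
  {A | (∀ i j, ‖A i j‖ ≤ 1) ∧ ‖A 1 0‖ ≤ (q : ℝ) ^ (-(e : ℤ))}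

/-- `A ∈ O` generates an OPTIMALLY embedded order `ℤ_q[A]`: "at least one of `b`, `c/q^e`, `a - d` is a unit". -/
def IsOptimalMat (q : ℕ) [Fact q.Prime] (e : ℕ) (A : Matrix (Fin 2) (Fin 2) ℚ_[q]) : Prop :=
  A ∈ eichlerSet q e ∧
    ¬ (‖A 0 1‖ < 1 ∧ ‖A 0 0 - A 1 1‖ < 1 ∧ ‖A 1 0‖ ≤ (q : ℝ) ^ (-((e + 1 : ℕ) : ℤ)))

/-- Conjugacy under the unit group of the standard Eichler order: `A' = μ⁻¹ A μ`, `μ ∈ O^×`. -/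
def EichConj (q : ℕ) [Fact q.Prime] (e : ℕ) (A A' : Matrix (Fin 2) (Fin 2) ℚ_[q]) : Prop :=
  ∃ μ : Matrix (Fin 2) (Fin 2) ℚ_[q], μ ∈ eichlerSet q e ∧ IsUnit μ.det ∧ μ⁻¹ ∈ eichlerSet q e ∧
    A' = μ⁻¹ * A * μ

/-- Voight's normalized matrix `N_x = (x 1; -f(x) t-x)`, `f = X² - tX + n` (Def. 30.6.8). -/
def normMat (t n x : ℚ_[q]) : Matrix (Fin 2) (Fin 2) ℚ_[q] := !![x, 1; -(x ^ 2 - t * x + n), t - x]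

/-- The Atkin–Lehner element `ϖ = (0 1; q^e 0)` of the normalizer (30.6.1). -/
def varpi (q : ℕ) [Fact q.Prime] (e : ℕ) : Matrix (Fin 2) (Fin 2) ℚ_[q] := !![0, 1; (q : ℚ_[q]) ^ e, 0]

/-- (gen 8) `A ≡ λ · 1 (mod q M₂(ℤ_q))`: the conjugation invariant separating the two kinds of classes. -/
def IsScalarModQ (A : Matrix (Fin 2) (Fin 2) ℚ_[q]) : Prop :=
  ‖A 0 1‖ < 1 ∧ ‖A 1 0‖ < 1 ∧ ‖A 0 0 - A 1 1‖ < 1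

/-- `#img({y mod q^{e+1} : y² - ty + n = 0} → ℤ/q^e)` — the second term of Voight Prop. 30.6.12 (gen 6). -/
def liftRootCount (q : ℕ) [Fact q.Prime] (e : ℕ) (t n : ℤ) : ℕ := by
  classical
  exact ((Finset.univ.filter fun y : ZMod (q ^ (e + 1)) =>
      y ^ 2 - (t : ZMod (q ^ (e + 1))) * y + (n : ZMod (q ^ (e + 1))) = 0).image
    (ZMod.castHom (pow_dvd_pow q (Nat.le_succ e)) (ZMod (q ^ e)))).card

theorem eichConj_refl (e : ℕ) (A : Matrix (Fin 2) (Fin 2) ℚ_[q]) : EichConj q e A A := by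
  have hq1 : (1 : ℝ) ≤ q := by exact_mod_cast hq.out.one_lt.le
  refine ⟨1, ⟨fun i j => ?_, ?_⟩, by simp, ⟨fun i j => ?_, ?_⟩, by simp⟩
  · fin_cases i <;> fin_cases j <;> simp
  · simp
  · fin_cases i <;> fin_cases j <;> simp
  · simp

/-- (g10 ✓, proof verbatim) `O` is closed under multiplication. -/
theorem eichlerSet_mul_mem {e : ℕ} {M N : Matrix (Fin 2) (Fin 2) ℚ_[q]} (hM : M ∈ eichlerSet q e)
    (hN : N ∈ eichlerSet q e) : M * N ∈ eichlerSet q e := by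
  have hq0 : (0 : ℝ) < q := by exact_mod_cast hq.out.pos
  have entry : ∀ i j, (M * N) i j = M i 0 * N 0 j + M i 1 * N 1 j := fun i j => by
    simp [Matrix.mul_apply, Fin.sum_univ_two]
  refine ⟨fun i j => ?_, ?_⟩
  · rw [entry]
    refine (Padic.nonarchimedean _ _).trans (max_le ?_ ?_)
    · rw [norm_mul]; exact mul_le_one₀ (hM.1 i 0) (norm_nonneg _) (hN.1 0 j)
    · rw [norm_mul]; exact mul_le_one₀ (hM.1 i 1) (norm_nonneg _) (hN.1 1 j)
  · rw [entry]
    refine (Padic.nonarchimedean _ _).trans (max_le ?_ ?_)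
    · rw [norm_mul]
      calc ‖M 1 0‖ * ‖N 0 0‖ ≤ (q : ℝ) ^ (-(e : ℤ)) * 1 :=
            mul_le_mul hM.2 (hN.1 0 0) (norm_nonneg _) (zpow_nonneg hq0.le _)
        _ = (q : ℝ) ^ (-(e : ℤ)) := mul_one _
    · rw [norm_mul]
      calc ‖M 1 1‖ * ‖N 1 0‖ ≤ 1 * (q : ℝ) ^ (-(e : ℤ)) :=
            mul_le_mul (hM.1 1 1) hN.2 (norm_nonneg _) zero_le_one
        _ = (q : ℝ) ^ (-(e : ℤ)) := one_mul _

theorem eichConj_symm {e : ℕ} {A A' : Matrix (Fin 2) (Fin 2) ℚ_[q]} (h : EichConj q e A A') :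
    EichConj q e A' A := by
  obtain ⟨μ, h1, hd, h2, rfl⟩ := h
  refine ⟨μ⁻¹, h2, ?_, ?_, ?_⟩
  · rw [Matrix.det_nonsing_inv]; exact hd.ringInverse
  · rw [Matrix.nonsing_inv_nonsing_inv _ hd]; exact h1
  · rw [Matrix.nonsing_inv_nonsing_inv _ hd, ← Matrix.mul_assoc, ← Matrix.mul_assoc,
      Matrix.mul_nonsing_inv _ hd, Matrix.one_mul, Matrix.mul_nonsing_inv_cancel_right _ _ hd]

theorem eichConj_trans {e : ℕ} {A A' A'' : Matrix (Fin 2) (Fin 2) ℚ_[q]} (h : EichConj q e A A')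
    (h' : EichConj q e A' A'') : EichConj q e A A'' := by
  obtain ⟨μ₁, h1, d1, i1, e1⟩ := h
  obtain ⟨μ₂, h2, d2, i2, e2⟩ := h'
  refine ⟨μ₁ * μ₂, eichlerSet_mul_mem h1 h2, ?_, ?_, ?_⟩
  · rw [Matrix.det_mul]; exact d1.mul d2
  · rw [Matrix.mul_inv_rev]; exact eichlerSet_mul_mem i2 i1
  · rw [e2, e1, Matrix.mul_inv_rev]
    simp only [Matrix.mul_assoc]

/-- The optimal matrices of the standard level-`q^e` order with the quadratic relation `X² - tX + n` (gen 10). -/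
def OptMat (q : ℕ) [Fact q.Prime] (e : ℕ) (t n : ℤ) : Type :=
  {A : Matrix (Fin 2) (Fin 2) ℚ_[q] //
    IsOptimalMat q e A ∧ A * A - ((t : ℚ) : ℚ_[q]) • A + ((n : ℚ) : ℚ_[q]) • (1 : Matrix (Fin 2) (Fin 2) ℚ_[q]) = 0}

/-- `O^×`-conjugacy on `OptMat` (gen 10). -/
def optMatSetoid (q : ℕ) [Fact q.Prime] (e : ℕ) (t n : ℤ) : Setoid (OptMat q e t n) where
  r A A' := EichConj q e A.1 A'.1
  iseqv := ⟨fun A => eichConj_refl e A.1, fun h => eichConj_symm h, fun h h' => eichConj_trans h h'⟩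

end Defs

/-! ## §1 The two index types of the count (T1: the `e ≥ 2` star index REPLACES the tree's `PLift (∃ k, …)`) -/

section Index

variable {q : ℕ} [hq : Fact q.Prime]

/-- Index of the NORMALIZED classes: roots of `f` in `ℤ/q^e` (tree, `e = 1`: `{k // k ∈ S}`, `S ⊆ range q`). -/
def Roots (q : ℕ) [Fact q.Prime] (e : ℕ) (t n : ℤ) : Type :=
  {x : ZMod (q ^ e) // x ^ 2 - (t : ZMod (q ^ e)) * x + (n : ZMod (q ^ e)) = 0}

/-- Index of the STAR (= scalar-mod-`q`, = "new `ϖ`-") classes: residues mod `q^e` of roots mod `q^{e+1}`, present only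
when `q ∣ d` (tree, `e = 1`: `PLift (∃ k₀, q ∣ t + 2k₀ ∧ q² ∣ f(k₀))`, a subsingleton). -/
def NewRoots (q : ℕ) [Fact q.Prime] (e : ℕ) (t n : ℤ) : Type :=
  {x : ZMod (q ^ e) // (q : ℤ) ∣ t ^ 2 - 4 * n ∧
    ∃ y : ZMod (q ^ (e + 1)), ZMod.castHom (pow_dvd_pow q (Nat.le_succ e)) (ZMod (q ^ e)) y = x ∧
      y ^ 2 - (t : ZMod (q ^ (e + 1))) * y + (n : ZMod (q ^ (e + 1))) = 0}

/-- A chosen root mod `q^{e+1}` above a new root (the lift whose `W`-matrix is integral AND scalar mod `q`). -/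
def NewRoots.lift {e : ℕ} {t n : ℤ} (x : NewRoots q e t n) : ZMod (q ^ (e + 1)) := x.2.2.choose

theorem NewRoots.lift_spec {e : ℕ} {t n : ℤ} (x : NewRoots q e t n) :
    ZMod.castHom (pow_dvd_pow q (Nat.le_succ e)) (ZMod (q ^ e)) x.lift = x.1 ∧
      x.lift ^ 2 - (t : ZMod (q ^ (e + 1))) * x.lift + (n : ZMod (q ^ (e + 1))) = 0 :=
  x.2.2.choose_spec

/-- H11.10 (XS) the normalized index has `rootCount` elements (definitional up to `Nat.card` of a subtype). -/
theorem natCard_roots (e : ℕ) (t n : ℤ) :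
    Nat.card (Roots q e t n) = rootCount (ZMod (q ^ e)) (t : ZMod (q ^ e)) (n : ZMod (q ^ e)) := by
  rfl

/-- H11.11 (S: `Finset.card_image`-free — the subtype IS the image) the star index has `[q ∣ d]·liftRootCount` elements. -/
theorem natCard_newRoots (e : ℕ) (t n : ℤ) :
    Nat.card (NewRoots q e t n) = if (q : ℤ) ∣ t ^ 2 - 4 * n then liftRootCount q e t n else 0 := by
  sorry

end Index

/-! ## §2 Representatives and the matrix lemmas (T2) -/

section Reps

variable {q : ℕ} [hq : Fact q.Prime]

/-- The `q`-adic integer underlying a residue (`ZMod.val` cast), used as the lift defining `N_x`. -/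
def padicOfZMod {m : ℕ} (x : ZMod m) : ℚ_[q] := ((x.val : ℤ) : ℚ_[q])

/-- Normalized representative of a root class: `N_{x̂}` for the standard lift `x̂ = x.val`. -/
def repN (e : ℕ) (t n : ℤ) (x : Roots q e t n) : Matrix (Fin 2) (Fin 2) ℚ_[q] :=
  normMat (t : ℚ_[q]) (n : ℚ_[q]) (padicOfZMod x.1)

/-- Star representative of a new-root class: `ϖ⁻¹ N_{ŷ} ϖ` for the chosen root `ŷ` mod `q^{e+1}` above `x`. -/
def repW (e : ℕ) (t n : ℤ) (x : NewRoots q e t n) : Matrix (Fin 2) (Fin 2) ℚ_[q] :=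
  (varpi q e)⁻¹ * normMat (t : ℚ_[q]) (n : ℚ_[q]) (padicOfZMod x.lift) * varpi q e

/-- H11.0 (XS) lift bookkeeping: `‖x̂‖ ≤ 1` and `‖f(x̂)‖ ≤ q^{-e}` for a root `x` mod `q^e`
(`padicNormE.norm_int_le_pow_iff_dvd` on `f(x.val) ∈ ℤ`, `(ZMod.intCast_zmod_eq_zero_iff_dvd)`). -/
theorem norm_f_padicOfZMod_le {m : ℕ} (hm : m ≠ 0) (t n : ℤ) (x : ZMod m)
    (hx : x ^ 2 - (t : ZMod m) * x + (n : ZMod m) = 0) :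
    ‖(padicOfZMod (q := q) x)‖ ≤ 1 ∧
      ‖(padicOfZMod (q := q) x) ^ 2 - (t : ℚ_[q]) * padicOfZMod x + (n : ℚ_[q])‖ ≤ ‖((m : ℤ) : ℚ_[q])‖ := by
  sorry

/-- H11.1 (S) `N_{x̂}` is an optimal matrix with the right relation (entry `(0,1) = 1` is a unit ⇒ optimal;
`(1,0) = -f(x̂)` has norm `≤ q^{-e}` by H11.0; the relation is the Cayley–Hamilton identity for `normMat`). -/
theorem repN_mem (e : ℕ) (t n : ℤ) (x : Roots q e t n) :
    IsOptimalMat q e (repN e t n x) ∧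
      repN e t n x * repN e t n x - ((t : ℚ) : ℚ_[q]) • repN e t n x +
        ((n : ℚ) : ℚ_[q]) • (1 : Matrix (Fin 2) (Fin 2) ℚ_[q]) = 0 := by
  sorry

/-- H11.2 (S) `ϖ⁻¹ N_{ŷ} ϖ = (t-ŷ, -f(ŷ)/q^e; q^e, ŷ)` is an optimal matrix with the right relation
(`‖f(ŷ)/q^e‖ ≤ q⁻¹ ≤ 1`; entry `(1,0) = q^e` has norm EXACTLY `q^{-e} > q^{-(e+1)}` ⇒ optimal; relation transported). -/
theorem repW_mem (e : ℕ) (t n : ℤ) (x : NewRoots q e t n) :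
    IsOptimalMat q e (repW e t n x) ∧
      repW e t n x * repW e t n x - ((t : ℚ) : ℚ_[q]) • repW e t n x +
        ((n : ℚ) : ℚ_[q]) • (1 : Matrix (Fin 2) (Fin 2) ℚ_[q]) = 0 := by
  sorry

/-- H11.3 (S) **(B ⇒), T2's two-entry argument** [Voight L. 30.6.9(a)]: an intertwiner `μ = (p r; c u) ∈ O^×`,
`N_x μ = μ N_{x'}`, has `p(x' - x) = c + r f(x')` (entries `(0,0)`, `(0,1)`), `‖c‖ ≤ q^{-e}`, `‖r f(x')‖ ≤ q^{-e}`, and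
`p` is a unit because `det μ = pu - rc` is a unit (`μ, μ⁻¹` integral) with `‖rc‖ < 1` (`1 ≤ e`).  No `‖x‖ ≤ 1` needed. -/
theorem norm_sub_le_of_eichConj_normMat {e : ℕ} (he : 1 ≤ e) {t n x x' : ℚ_[q]}
    (hfx' : ‖x' ^ 2 - t * x' + n‖ ≤ (q : ℝ) ^ (-(e : ℤ)))
    (h : EichConj q e (normMat t n x) (normMat t n x')) :
    ‖x - x'‖ ≤ (q : ℝ) ^ (-(e : ℤ)) := by
  sorry

/-- H11.4 (S) **(B ⇐)** [= gen 8 `eichConj_normMat_of_norm_sub_le`]: the shear `μ = (1 0; x'-x 1) ∈ O^×`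
(needs exactly `‖x' - x‖ ≤ q^{-e}`) satisfies `μ N_{x'} = N_x μ` identically
(`f(x) - f(x') = (x' - x)(t - x - x')`), so `N_{x'} = μ⁻¹ N_x μ`.  No other hypothesis. -/
theorem eichConj_normMat_of_norm_sub_le {e : ℕ} {t n x x' : ℚ_[q]}
    (h : ‖x - x'‖ ≤ (q : ℝ) ^ (-(e : ℤ))) :
    EichConj q e (normMat t n x) (normMat t n x') := by
  sorry

/-- H11.5 (S, g9 ✓ `EichConj.map_varpi` / `.of_varpi` with `varpi_inv_mul_mul_varpi`) **`ϖ`-transport**: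
`ϖ` normalizes `O`, so conjugating both sides by `ϖ` preserves AND reflects `O^×`-conjugacy. -/
theorem eichConj_varpi_iff {e : ℕ} (A B : Matrix (Fin 2) (Fin 2) ℚ_[q]) :
    EichConj q e ((varpi q e)⁻¹ * A * varpi q e) ((varpi q e)⁻¹ * B * varpi q e) ↔ EichConj q e A B := by
  sorry

/-- H11.6 (XS) the star representative IS scalar mod `q` (`1 ≤ e`): entries `(0,1) = -f(ŷ)/q^e` (norm `≤ q⁻¹` as
`q^{e+1} ∣ f(ŷ)`), `(1,0) = q^e`, `(0,0) - (1,1) = t - 2ŷ` with `(t - 2ŷ)² = d + 4 f(ŷ)`, `q ∣ d` ⇒ `‖t - 2ŷ‖ < 1`. -/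
theorem isScalarModQ_repW {e : ℕ} (he : 1 ≤ e) (t n : ℤ) (x : NewRoots q e t n) :
    IsScalarModQ (repW e t n x) := by
  sorry

/-- H11.6′ (XS, the converse bookkeeping used for `[q ∣ d]`): for `‖x‖ ≤ 1` with `‖f(x)‖ < 1`,
`‖t - 2x‖ < 1 ↔ q ∣ t² - 4n` (`(t - 2x)² = (t² - 4n) + 4 f(x)`, ultrametric). -/
theorem norm_sub_two_mul_lt_one_iff {t n : ℤ} {x : ℚ_[q]} (hx : ‖x‖ ≤ 1)
    (hfx : ‖x ^ 2 - (t : ℚ_[q]) * x + (n : ℚ_[q])‖ < 1) :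
    ‖(t : ℚ_[q]) - 2 * x‖ < 1 ↔ (q : ℤ) ∣ t ^ 2 - 4 * n := by
  sorry

/-- H11.7 (XS, g9 ✓ `isScalarModQ_iff_of_eichConj` + `not_isScalarModQ_normMat`) **disjointness**: a normalized
matrix (`(0,1)`-entry `1`) is never scalar mod `q`, and `IsScalarModQ` is a class invariant. -/
theorem not_eichConj_normMat_of_isScalarModQ {e : ℕ} {t n x : ℚ_[q]} {W : Matrix (Fin 2) (Fin 2) ℚ_[q]}
    (hW : IsScalarModQ W) : ¬ EichConj q e (normMat t n x) W := by
  sorry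

/-- H11.8 (g9 ✓ `exists_eichConj_normMat_of_not_isScalarModQ`, verbatim) dichotomy, normalized half. -/
theorem exists_eichConj_normMat_of_not_isScalarModQ {e : ℕ} (he : 1 ≤ e) {t n : ℚ_[q]}
    {A : Matrix (Fin 2) (Fin 2) ℚ_[q]} (hA : IsOptimalMat q e A)
    (hchar : A * A - t • A + n • (1 : Matrix (Fin 2) (Fin 2) ℚ_[q]) = 0) (hns : ¬ IsScalarModQ A) :
    ∃ x : ℚ_[q], ‖x‖ ≤ 1 ∧ ‖x ^ 2 - t * x + n‖ ≤ (q : ℝ) ^ (-(e : ℤ)) ∧ EichConj q e A (normMat t n x) := by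
  sorry

/-- H11.9 (g9 ✓ `exists_eichConj_varpi_of_isScalarModQ`, verbatim) dichotomy, star half. -/
theorem exists_eichConj_varpi_of_isScalarModQ {e : ℕ} {t n : ℚ_[q]} {A : Matrix (Fin 2) (Fin 2) ℚ_[q]}
    (hA : IsOptimalMat q e A) (hchar : A * A - t • A + n • (1 : Matrix (Fin 2) (Fin 2) ℚ_[q]) = 0)
    (hs : IsScalarModQ A) :
    ‖A 1 0‖ = (q : ℝ) ^ (-(e : ℤ)) ∧
      (∃ x : ℚ_[q], ‖x‖ ≤ 1 ∧ ‖x ^ 2 - t * x + n‖ ≤ (q : ℝ) ^ (-((e + 1 : ℕ) : ℤ)) ∧ ‖t - 2 * x‖ < 1 ∧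
        EichConj q e A ((varpi q e)⁻¹ * normMat t n x * varpi q e)) ∧
      ∀ x' : ℚ_[q], ¬ EichConj q e A (normMat t n x') := by
  sorry

/-- H11.12 (S) residues vs. `q`-adic lifts: two roots mod `q^e` are equal iff their standard lifts are `q^e`-close;
and a `q`-adic integer `x` with `‖f(x)‖ ≤ q^{-e}` is `q^e`-close to the standard lift of SOME root mod `q^e`
(`PadicInt.toZModPow`; this is the glue between H11.8/H11.9's `∃ x : ℚ_[q]` and the finite index types). -/
theorem norm_padicOfZMod_sub_le_iff {e : ℕ} (x x' : ZMod (q ^ e)) :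
    ‖padicOfZMod (q := q) x - padicOfZMod x'‖ ≤ (q : ℝ) ^ (-(e : ℤ)) ↔ x = x' := by
  sorry

theorem exists_root_near {e : ℕ} (t n : ℤ) {x : ℚ_[q]} (hx : ‖x‖ ≤ 1)
    (hfx : ‖x ^ 2 - (t : ℚ_[q]) * x + (n : ℚ_[q])‖ ≤ (q : ℝ) ^ (-(e : ℤ))) :
    ∃ r : Roots q e t n, ‖x - padicOfZMod r.1‖ ≤ (q : ℝ) ^ (-(e : ℤ)) := by
  sorry

end Reps

/-! ## §3 The scaffold (clone of the tree's `e = 1` proof) and the target H10.14 -/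

section Count

variable {q : ℕ} [hq : Fact q.Prime]

/-- The class of a normalized representative. -/
def classN (e : ℕ) (t n : ℤ) (x : Roots q e t n) : Quotient (optMatSetoid q e t n) :=
  Quotient.mk _ ⟨repN e t n x, repN_mem e t n x⟩

/-- The class of a star representative. -/
def classW (e : ℕ) (t n : ℤ) (x : NewRoots q e t n) : Quotient (optMatSetoid q e t n) :=
  Quotient.mk _ ⟨repW e t n x, repW_mem e t n x⟩

/-- H11.13 (S–M, THE prover target; tree template ll. 1583–1608 of EichlerEmbeddingLocalLevel.lean) the counting
bijection: `Sum.elim classN classW` is a bijection.  Injective on `Roots` by H11.3 + H11.12; injective on `NewRoots` by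
H11.5 + H11.3 (at level `e`, using `‖f(ŷ)‖ ≤ q^{-(e+1)} ≤ q^{-e}`) + H11.12; the two images are disjoint by H11.6 +
H11.7; surjective by the gen-9 dichotomy H11.8/H11.9 + `exists_root_near` + H11.4 (+ H11.5, H11.6′ for the star half:
`‖t - 2x‖ < 1` gives `q ∣ d`, and `x mod q^{e+1}` is a root above `x mod q^e`). -/
theorem sumElim_classN_classW_bijective {e : ℕ} (he : 1 ≤ e) (t n : ℤ) :
    Function.Bijective (Sum.elim (classN (q := q) e t n) (classW e t n)) := by
  sorry

/-- **H10.14′ (degenerate parameter `d = 0` INCLUDED — FAMILY 3 finding of this generation):** the count needs NO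
`t² - 4n ≠ 0`; the scaffold never uses it and the exact census passes at `d = 0` (12 cases, `q ∈ {2,3,5}`, `e ≤ 5`:
e.g. `(q,e,t,n) = (3,4,2,1)`: `12 = 9 + 3` classes).  3-line consequence of H11.13 + H11.10 + H11.11
(`Nat.card_congr (Equiv.ofBijective …)`, `Nat.card_sum`) — kernel-checked modulo the named stubs. -/
theorem card_optMat_classes_eq' {e : ℕ} (he : 1 ≤ e) (t n : ℤ) :
    Nat.card (Quotient (optMatSetoid q e t n)) =
      rootCount (ZMod (q ^ e)) (t : ZMod (q ^ e)) (n : ZMod (q ^ e)) +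
        (if (q : ℤ) ∣ t ^ 2 - 4 * n then liftRootCount q e t n else 0) := by
  haveI : Finite (Roots q e t n) := by unfold Roots; infer_instance
  haveI : Finite (NewRoots q e t n) := by unfold NewRoots; infer_instance
  rw [← Nat.card_congr (Equiv.ofBijective _ (sumElim_classN_classW_bijective (q := q) he t n)), Nat.card_sum,
    natCard_roots, natCard_newRoots]

/-- **H10.14 = Voight Prop. 30.6.12 / Hijikata 1974 Thm. 2.3**, gen 10's statement VERBATIM (incl. the now-redundant
`hd`), so that gen 10's kernel-checked composition `localEmbeddingNumber_eq_rootCount` consumes it unchanged. -/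
theorem card_optMat_classes_eq {e : ℕ} (he : 1 ≤ e) (t n : ℤ) (hd : t ^ 2 - 4 * n ≠ 0) :
    Nat.card (Quotient (optMatSetoid q e t n)) =
      rootCount (ZMod (q ^ e)) (t : ZMod (q ^ e)) (n : ZMod (q ^ e)) +
        (if (q : ℤ) ∣ t ^ 2 - 4 * n then liftRootCount q e t n else 0) :=
  card_optMat_classes_eq' he t n

end Count

/-! ## §4 Kernel shadows of T2/T3 (decide): the shear intertwiner identity over `ℤ`, and one deep-regime count -/

/-- T2 over `ℤ` at `t = 3, n = 7, x = 2, x' = 10` (`q^e = 8 ∣ x' - x`): `μ N_{x'} = N_x μ` for `μ = (1 0; 8 1)`,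
`N_x = (2 1; -5 1)` (`f(2) = 4 - 6 + 7 = 5`), `N_{x'} = (10 1; -77 -7)` (`f(10) = 77`). PROVED. -/
example : !![(1 : ℤ), 0; 8, 1] * !![10, 1; -77, -7] = !![(2 : ℤ), 1; -5, 1] * !![1, 0; 8, 1] := by decide

/-- T3 shadow (census row `(q,e,t,n) = (2,3,2,-15)`, `d = 64 = 2^6`, the deep regime `v₂(d) = 2e`):
`rootCount (ℤ/8) = #{1, 5} = 2` and the roots mod `16` of `(x-1)² - 16` (`{1, 5, 9, 13}`) project onto the `2` residues
`{1, 5}` mod `8`, so the formula gives `2 + 2 = 4` classes — TWO star classes, the `e ≥ 2` phenomenon — and the exact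
`O^×`-census finds exactly `4`.  Both counts by `decide`. -/
example : ((Finset.range 8).filter fun x : ℕ => (8 : ℤ) ∣ (x : ℤ) ^ 2 - 2 * x - 15).card = 2 := by decide

example : (((Finset.range 16).filter fun y : ℕ => (16 : ℤ) ∣ (y : ℤ) ^ 2 - 2 * y - 15).image (· % 8)).card = 2 := by
  decide

end Summit.ABC.ABC.Cruxes.DefiniteRTControlPrime.StubIdeas3g11

end
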